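import Mathlib
import Literature.NumberTheory.LFunctions.Zhang2022.Section13ZeroSumConversion
import HarnessLib

/-!
# Zhang (2022) §13 p. 75, (13.11): the zero-sum `Σ_{ρ∈𝔷(ψ)} |L(ρ+β₁,ψ)/L′(ρ,ψ)|·H(ρ)·ω(ρ)` is bounded by
# `C·𝓛⁹·∫_{𝒥(±α)} |H||ω| |ds| + O(‖H‖_∞ e^{−𝓛¹⁰/8})` — "(2.34) … the right side being estimated via
# Lemma 5.9", for a GENERIC holomorphic co-factor `H`

Topic `Literature/NumberTheory/LFunctions/Zhang2022` (Landau–Siegel audit tree; verdict-neutral).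
Y. Zhang, *Discrete mean estimates and the Landau–Siegel zero*, arXiv:2211.02515v1 (2022)
[Zhang2022LandauSiegel], §13 p. 75 (tex L3806–L3817) — an unrefereed manuscript under adjudication;
nothing here asserts or denies its Theorems 1–2. Lane ZHANG-L (WP14), GAP row G-L3t6-3 ((13.11),
"not carried out in print"; typed reconstructed shapes `Typed.Section13.U007a/b/c`).

After the (2.34)/residue conversion of `Section13ZeroSumConversion` (`zeroSum_conversion_eq234_of_prop22`:
`Σ_ρ |L(ρ+β₁)/L′(ρ)|·H(ρ)ω(ρ) = −i(segInt_α F_H − segInt_{−α} F_H) + O(‖H‖_∞ e^{−𝓛¹⁰/8})`,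
`F_H = [M(s+β₁)/M(s)]·H·ω`), the printed "estimated via Lemma 5.9" is the sup bound
`‖M(s+β₁,ψ)/M(s,ψ)‖ ≪ log P` on `𝒥(±α)` (the typed `U007a`, landed by sz-d40 as an edge from the leaf
`Skeleton.Lemma59`). Here:

* `u007a_of_prop22` — **`U007a c′` from Proposition 2.2 alone** (`0 ≤ c′`): sz-d40's `u007a_of` re-run
  over the tree theorem `Skeleton.lemma59_restricted_of_prop22` (Lemma 5.9 on `|t − 2πt₀| ≤ 𝓛₁ + ¼`,
  from Prop. 2.2) instead of the leaf `Skeleton.Lemma59`; `u007a_eventually` — outright for large `c′`;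
* `zeroSum_weight_le_of_prop22` — **the generic bound**: for `c′ ≥ 0` with `Skeleton.Prop22 c′` there are
  `K, C ≥ 0` such that for all large `D`, every `ψ ∈ Ψ₁`, every `H` holomorphic on the upper half-plane
  with `‖H‖ ≤ H_max` on `|σ−½| ≤ α`, `|t−2πt₀| ≤ 𝓛₁+1`:
  `‖Σ_{ρ∈𝔷(ψ)} |L(ρ+β₁,ψ)/L′(ρ,ψ)|·H(ρ)·ω(ρ)‖`
  `≤ C·𝓛⁹·Σ_± ∫_{−𝓛₁}^{𝓛₁} ‖H(±α+s₀+iv)‖·‖ω(±α+s₀+iv)‖ dv + K·H_max·e^{−𝓛¹⁰/8}`;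
  `zeroSum_weight_le_eventually` — the same for every sufficiently large `c′`, NO hypothesis.

With `H = F·F̄(1−·)` (so that `H(ρ) = |F(ρ)|²` at the critical zeros) this is the inequality behind every
term of `𝓔` after Cauchy's inequality; the remaining inputs are the mean values `Σ_{ψ}∫|F|²|ω|`
("Lemma 6.1 and 3.3"). Theorems only: no new definition, no new fact, axioms standard.

## References

* Y. Zhang, arXiv:2211.02515v1 (2022), §13 p. 75, tex L3806–L3817; §5 Lemma 5.9; §2 (2.34), Prop. 2.2.
  [cite: Zhang2022LandauSiegel, §13 p.75]
-/

noncomputable section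

open Complex Real Set Filter Topology MeasureTheory intervalIntegral

namespace Literature.NumberTheory.LFunctions.Zhang2022.Typed.Section13

open Skeleton GammaFactor Section8aStatements

/-! ## Parameter bookkeeping (private) -/

/-- `β₁ = iv₁`, `v₁ = α(1−5c′α𝓛)`. [cite: Zhang2022LandauSiegel, §2 (2.13)] -/
private theorem beta1_eq_v' (c' : ℝ) (D : ℕ) :
    beta1 c' D = ((alpha D * (1 - 5 * c' * alpha D * ell D) : ℝ) : ℂ) * I := by
  simp only [beta1]; push_cast; ring

/-- For `𝓛 ≥ 1`: `0 < α ≤ π/𝓛` and `|v₁| ≤ 3α(1+5π|c′|)`. [cite: Zhang2022LandauSiegel, §2 (2.10), (2.13)] -/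
private theorem alpha_v1_bounds' {c' : ℝ} {D : ℕ} (hℓ : 1 ≤ ell D) :
    0 < alpha D ∧ alpha D ≤ π / ell D ∧
      |alpha D * (1 - 5 * c' * alpha D * ell D)| ≤ 3 * alpha D * (1 + 5 * π * |c'|) := by
  have hℓ0 : 0 < ell D := by linarith
  have h9 : 1 ≤ ell D ^ 9 := one_le_pow₀ hℓ
  have hα : alpha D = π / ell D ^ 9 := by rw [alpha, bigP, Real.log_exp]
  have hαpos : 0 < alpha D := by rw [hα]; positivity
  have h8 : ell D ≤ ell D ^ 9 := by
    calc ell D = ell D ^ 1 := (pow_one _).symm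
      _ ≤ ell D ^ 9 := pow_le_pow_right₀ hℓ (by norm_num)
  have hαℓ : alpha D * ell D ≤ π := by
    calc alpha D * ell D ≤ alpha D * ell D ^ 9 := by gcongr
      _ = π := by rw [hα, div_mul_cancel₀ _ (by positivity)]
  have hαℓ0 : 0 ≤ alpha D * ell D := by positivity
  refine ⟨hαpos, by rw [le_div_iff₀ hℓ0]; exact hαℓ, ?_⟩
  have hb : |5 * c' * alpha D * ell D| ≤ 5 * π * |c'| := by
    rw [show 5 * c' * alpha D * ell D = 5 * c' * (alpha D * ell D) by ring, abs_mul, abs_mul,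
      abs_of_nonneg (by norm_num : (0 : ℝ) ≤ 5), abs_of_nonneg hαℓ0]
    calc 5 * |c'| * (alpha D * ell D) ≤ 5 * |c'| * π := by gcongr
      _ = 5 * π * |c'| := by ring
  rw [abs_mul, abs_of_nonneg hαpos.le]
  have h1 : |1 - 5 * c' * alpha D * ell D| ≤ 1 + 5 * π * |c'| := by
    calc |1 - 5 * c' * alpha D * ell D| ≤ |(1 : ℝ)| + |5 * c' * alpha D * ell D| := abs_sub _ _
      _ ≤ 1 + 5 * π * |c'| := by rw [abs_one]; linarith
  have hK0 : 0 ≤ 1 + 5 * π * |c'| := by positivity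
  calc alpha D * |1 - 5 * c' * alpha D * ell D| ≤ alpha D * (1 + 5 * π * |c'|) := by gcongr
    _ ≤ 3 * alpha D * (1 + 5 * π * |c'|) := by nlinarith [mul_nonneg hαpos.le hK0]

/-! ## `U007a` — "estimated via Lemma 5.9" — from Proposition 2.2 -/

/-- **The sup bound on `𝒥(±α)` from Proposition 2.2 alone** (no Assumption (A)): for `c′ ≥ 0` with
`Skeleton.Prop22 c′` there is `C ≥ 0` with, for all large `D`, every `ψ ∈ Ψ₁`, `σ = ±α`, `|v| ≤ 𝓛₁`:
`‖M(σ+s₀+iv+β₁,ψ)/M(σ+s₀+iv,ψ)‖ ≤ C log P`. sz-d40's `u007a_of`, with Lemma 5.9 supplied by the tree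
theorem `Skeleton.lemma59_restricted_of_prop22` (clearance `α` on `σ = ½ ± α` by Prop. 2.2 (i),
`zero_clearance_of_re_half`; `|Y(s+β₁)/Y(s)| ≤ e`, `Yroot_shift_eq_mul`); `C = e·max(C₅.₉, 0)`.
[cite: Zhang2022LandauSiegel, §13 p.75 ("estimated via Lemma 5.9"); §5 Lemma 5.9] -/
theorem norm_Mratio_le_of_prop22 {c' : ℝ} (hc' : 0 ≤ c') (h22 : Prop22 c') :
    ∃ C : ℝ, 0 ≤ C ∧ ForAllLarge fun D _ χ => ∀ x ∈ PsiOne χ, ∀ σ : ℝ,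
      (σ = alpha D ∨ σ = -alpha D) → ∀ v : ℝ, |v| ≤ ell1 D →
        ‖Mfun x.ψ ((σ : ℂ) + s0 D + v * I + beta1 c' D) / Mfun x.ψ ((σ : ℂ) + s0 D + v * I)‖ ≤
          C * Real.log (bigP D) := by
  -- adapted from Section13U007a.u007a_of (sz-d40): Lemma59 ↦ lemma59_restricted_of_prop22
  obtain ⟨C₁, D₁, h59⟩ := lemma59_restricted_of_prop22 hc' h22 1 one_pos
  obtain ⟨D₂, h22i⟩ := h22.1
  set K : ℝ := 1 + 5 * π * |c'| with hK
  have hK1 : 1 ≤ K := by rw [hK]; nlinarith [pi_pos, abs_nonneg c']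
  set M : ℝ := 16 + 3 * π * K with hM
  refine ⟨Real.exp 1 * max C₁ 0, by positivity, max (max D₁ D₂) ⌈Real.exp M⌉₊,
    fun D _ χ hD hq hp x hx σ hσ v hv => ?_⟩
  have hD₁ : D₁ ≤ D := le_trans (le_trans (le_max_left _ _) (le_max_left _ _)) hD
  have hD₂ : D₂ ≤ D := le_trans (le_trans (le_max_right _ _) (le_max_left _ _)) hD
  have hDM : ⌈Real.exp M⌉₊ ≤ D := le_trans (le_max_right _ _) hD
  -- `𝓛 ≥ M ≥ 16`
  have hDreal : Real.exp M ≤ (D : ℝ) := le_trans (Nat.le_ceil _) (by exact_mod_cast hDM)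
  have hDpos : (0 : ℝ) < D := lt_of_lt_of_le (Real.exp_pos M) hDreal
  have hℓM : M ≤ ell D := by rw [ell]; exact (Real.le_log_iff_exp_le hDpos).mpr hDreal
  have hM16 : 16 ≤ M := by rw [hM]; nlinarith [pi_pos]
  have hℓ1 : 1 ≤ ell D := by linarith
  have hℓpos : 0 < ell D := by linarith
  have ht0ℓ : ell D ≤ t0 D := by rw [t0]; exact le_self_pow₀ hℓ1 (by norm_num)
  have ht0pos : 0 < t0 D := by linarith
  have hℓ1t0 : ell1 D ≤ t0 D := by rw [ell1, t0]; exact pow_le_pow_right₀ hℓ1 (by norm_num)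
  obtain ⟨hαpos, hαπℓ, hav1⟩ := alpha_v1_bounds' (c' := c') hℓ1
  have h3αK : 3 * alpha D * K ≤ 1 := by
    calc 3 * alpha D * K ≤ 3 * (π / ell D) * K := by gcongr
      _ = (3 * π * K) / ell D := by ring
      _ ≤ 1 := by rw [div_le_one hℓpos]; linarith
  have hα4 : alpha D ≤ 1 / 4 := by
    have : alpha D ≤ 3 * alpha D * K := by nlinarith
    have h2 : alpha D ≤ π / ell D := hαπℓ
    rw [le_div_iff₀ hℓpos] at h2
    nlinarith [Real.pi_lt_four]
  set v1 : ℝ := alpha D * (1 - 5 * c' * alpha D * ell D) with hv1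
  have hv1small : |v1| ≤ 1 := le_trans hav1 h3αK
  -- the point `s = (1/2 + σ) + i(2πt₀ + v)`
  set s : ℂ := (σ : ℂ) + s0 D + v * I with hs
  set σ' : ℝ := 1 / 2 + σ with hσ'
  set t : ℝ := 2 * π * t0 D + v with ht
  have hs_eq : s = (σ' : ℂ) + t * I := by
    apply Complex.ext
    · simp [hs, hσ', s0_re]; ring
    · simp [hs, ht, s0_im]
  have hsre : s.re = 1 / 2 + σ := by rw [hs_eq]; simp [hσ']
  have hsim : s.im = 2 * π * t0 D + v := by rw [hs_eq]; simp [ht]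
  have hσabs : |σ| = alpha D := by
    rcases hσ with h | h
    · rw [h, abs_of_pos hαpos]
    · rw [h, abs_neg, abs_of_pos hαpos]
  have hre_abs : |s.re - 1 / 2| = alpha D := by rw [hsre, show 1 / 2 + σ - 1 / 2 = σ by ring, hσabs]
  have him_abs : |s.im - 2 * π * t0 D| ≤ ell1 D := by
    rw [hsim, show 2 * π * t0 D + v - 2 * π * t0 D = v by ring]; exact hv
  -- Lemma 5.9 at `s` (restricted range, from Prop. 2.2)
  have hclear := zero_clearance_of_re_half χ x (h22i D χ hD₂ hq hp x hx) hre_abs him_abs hαpos hα4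
  have hL := h59 D χ hD₁ hq hp x hx s hre_abs.le (by linarith [him_abs]) hclear
  have hlogP : 0 ≤ Real.log (bigP D) := by rw [bigP, Real.log_exp]; positivity
  -- the `Y`-ratio
  have hσ'0 : 0 < σ' := by
    rcases hσ with h | h <;> rw [hσ', h] <;> linarith
  have hσ'1 : σ' ≤ 1 := by
    rcases hσ with h | h <;> rw [hσ', h] <;> linarith
  have ht8 : 8 ≤ t := by
    rw [ht]
    have := (abs_le.mp hv).1
    have hπ : (3 : ℝ) < π := Real.pi_gt_three
    nlinarith
  obtain ⟨E, hE, hYs⟩ := Yroot_shift_eq_mul x (v := v1) hσ'0 hσ'1 ht8 hv1small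
  have hY0 : Yroot x.ψ ((σ' : ℂ) + t * I) ≠ 0 := by
    obtain ⟨-, hYsq⟩ := Yroot_spec x.prim
    have him0 : 0 < ((σ' : ℂ) + t * I).im := by simp; linarith
    intro h0
    have := hYsq _ him0
    rw [h0, zero_pow two_ne_zero] at this
    exact inv_ne_zero (Zfac_ne_zero x.prim him0) this.symm
  have hβ : s + beta1 c' D = (σ' : ℂ) + t * I + (v1 : ℂ) * I := by rw [beta1_eq_v', hs_eq]
  have hratio : Mfun x.ψ (s + beta1 c' D) / Mfun x.ψ s =
      E * (x.ψ.LFunction (s + beta1 c' D) / x.ψ.LFunction s) := by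
    have h1 : Mfun x.ψ (s + beta1 c' D) = Yroot x.ψ ((σ' : ℂ) + t * I) * E *
        x.ψ.LFunction (s + beta1 c' D) := by
      rw [Mfun, hβ, hYs]
    have h2 : Mfun x.ψ s = Yroot x.ψ ((σ' : ℂ) + t * I) * x.ψ.LFunction s := by
      rw [Mfun, hs_eq]
    rw [h1, h2, mul_assoc, mul_div_mul_left _ _ hY0, mul_div_assoc]
  show ‖Mfun x.ψ (s + beta1 c' D) / Mfun x.ψ s‖ ≤ Real.exp 1 * max C₁ 0 * Real.log (bigP D)
  rw [hratio, norm_mul]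
  have hL' : ‖x.ψ.LFunction (s + beta1 c' D) / x.ψ.LFunction s‖ ≤ max C₁ 0 * Real.log (bigP D) :=
    hL.trans (mul_le_mul_of_nonneg_right (le_max_left _ _) hlogP)
  calc ‖E‖ * ‖x.ψ.LFunction (s + beta1 c' D) / x.ψ.LFunction s‖
      ≤ Real.exp 1 * (max C₁ 0 * Real.log (bigP D)) :=
        mul_le_mul hE hL' (norm_nonneg _) (Real.exp_nonneg _)
    _ = Real.exp 1 * max C₁ 0 * Real.log (bigP D) := by ring

/-- **`Z22:§13.u007`, "estimated via Lemma 5.9" (`Typed.Section13.U007a c′`) from Proposition 2.2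
alone**: `0 ≤ c′ → Skeleton.Prop22 c′ → U007a c′` (Assumption (A) unused). Supersedes the edge
`u007a_of : Prop22i → Lemma59 c′ → U007a c′` (sz-d40) in that Lemma 5.9 is now supplied by the tree
theorem `Skeleton.lemma59_restricted_of_prop22`. [cite: Zhang2022LandauSiegel, §13 p.75; §5 Lemma 5.9] -/
theorem u007a_of_prop22 {c' : ℝ} (hc' : 0 ≤ c') (h22 : Prop22 c') : U007a c' := by
  obtain ⟨C, -, D₀, h⟩ := norm_Mratio_le_of_prop22 hc' h22
  exact ⟨C, D₀, fun D _ χ hD hq hp _ x hx σ hσ v hv => h D χ hD hq hp x hx σ hσ v hv⟩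

/-- **`U007a c′` for every sufficiently large `c′`, NO hypothesis** (Prop. 2.2 is a tree theorem for
large `c′`, `Skeleton.prop22_eventually`). [cite: Zhang2022LandauSiegel, §13 p.75; §5 Lemma 5.9] -/
theorem u007a_eventually : ∃ c₀ : ℝ, 0 ≤ c₀ ∧ ∀ c' : ℝ, c₀ ≤ c' → U007a c' := by
  obtain ⟨c₀, hc₀, h⟩ := prop22_eventually
  exact ⟨c₀, hc₀, fun c' hc' => u007a_of_prop22 (hc₀.trans hc') (h c' hc')⟩

/-! ## The generic zero-sum bound -/

/-- Continuity of `v ↦ ‖H(z+s₀+iv)‖·‖ω(z+s₀+iv)‖` on `[−𝓛₁, 𝓛₁]` for `H` holomorphic on the upper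
half-plane (`Im(z+s₀+iv) = 2πt₀ + v > 0` there once `𝓛₁ < 2πt₀`, `z` real).
[cite: Zhang2022LandauSiegel, §13 p.75] -/
theorem continuousOn_normH_mul_normOmega {D : ℕ} (H : ℂ → ℂ)
    (hH : ∀ z : ℂ, 0 < z.im → DifferentiableAt ℂ H z) (z : ℝ) (hℓt : ell1 D < 2 * π * t0 D) :
    ContinuousOn (fun v : ℝ => ‖H ((z : ℂ) + s0 D + v * I)‖ * ‖omegaW D ((z : ℂ) + s0 D + v * I)‖)
      (Icc (-ell1 D) (ell1 D)) := by
  intro v hv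
  apply ContinuousAt.continuousWithinAt
  have hline : ContinuousAt (fun v : ℝ => (z : ℂ) + s0 D + v * I) v := by fun_prop
  have him : 0 < ((z : ℂ) + s0 D + (v : ℂ) * I).im := by
    simp [s0_im]; linarith [hv.1]
  have hHc : ContinuousAt (fun v : ℝ => H ((z : ℂ) + s0 D + v * I)) v :=
    (hH _ him).continuousAt.comp_of_eq hline rfl
  have hω : Continuous fun v : ℝ => omegaW D ((z : ℂ) + s0 D + v * I) :=
    (Ded81Edge.continuous_omega (ell2 D) (t0 D)).comp (by fun_prop : Continuous fun v : ℝ => (z : ℂ) + s0 D + v * I)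
  exact hHc.norm.mul hω.continuousAt.norm

set_option maxHeartbeats 400000 in
/-- **The zero-sum bound for a generic holomorphic co-factor, from Proposition 2.2** (§13 p.75,
"(2.34) … the right side being estimated via Lemma 5.9", made explicit): for `c′ ≥ 0` with
`Skeleton.Prop22 c′` there are `K, C ≥ 0` such that for all large `D`, every `ψ ∈ Ψ₁`, every `H`
holomorphic on the upper half-plane and `H_max ≥ 0` with `‖H(s)‖ ≤ H_max` on `|σ−½| ≤ α`,
`|t−2πt₀| ≤ 𝓛₁+1`:
`‖Σ_{ρ∈𝔷(ψ)} |L(ρ+β₁,ψ)/L′(ρ,ψ)|·H(ρ)·ω(ρ)‖ ≤ C·𝓛⁹·(∫_{−𝓛₁}^{𝓛₁}‖H(α+s₀+iv)‖‖ω(α+s₀+iv)‖dv`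
`+ ∫_{−𝓛₁}^{𝓛₁}‖H(−α+s₀+iv)‖‖ω(−α+s₀+iv)‖dv) + K·H_max·e^{−𝓛¹⁰/8}` — the conversion
`zeroSum_conversion_eq234_of_prop22` followed by `‖segInt_{±α}F_H‖ ≤ (1/2π)∫‖F_H‖ ≤ (C log P/2π)∫‖H‖‖ω‖`
(`‖M(s+β₁)/M(s)‖ ≤ C log P = C𝓛⁹` on `𝒥(±α)`, `norm_Mratio_le_of_prop22`; `1/2π ≤ 1`).
[cite: Zhang2022LandauSiegel, §13 p.75, tex L3806–L3817] -/
theorem zeroSum_weight_le_of_prop22 {c' : ℝ} (hc' : 0 ≤ c') (h22 : Prop22 c') :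
    ∃ K : ℝ, 0 ≤ K ∧ ∃ C : ℝ, 0 ≤ C ∧ ForAllLarge fun D _ χ => ∀ x ∈ PsiOne χ,
      ∀ (H : ℂ → ℂ) (Hmax : ℝ), 0 ≤ Hmax → (∀ z : ℂ, 0 < z.im → DifferentiableAt ℂ H z) →
      (∀ s : ℂ, |s.re - 1 / 2| ≤ alpha D → |s.im - 2 * π * t0 D| ≤ ell1 D + 1 → ‖H s‖ ≤ Hmax) →
      ‖∑ ρ ∈ finsetOf (zeroSet D x),
          ((‖x.ψ.LFunction (ρ + beta1 c' D) / deriv x.ψ.LFunction ρ‖ : ℝ) : ℂ) * H ρ * omegaW D ρ‖ ≤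
        C * ell D ^ 9 *
            ((∫ v in (-ell1 D)..ell1 D,
                ‖H ((alpha D : ℂ) + s0 D + v * I)‖ * ‖omegaW D ((alpha D : ℂ) + s0 D + v * I)‖) +
              (∫ v in (-ell1 D)..ell1 D,
                ‖H (((-alpha D : ℝ) : ℂ) + s0 D + v * I)‖ *
                  ‖omegaW D (((-alpha D : ℝ) : ℂ) + s0 D + v * I)‖)) +
          K * Hmax * Real.exp (-(ell D ^ 10 / 8)) := by
  obtain ⟨K, hK0, D₁, hconv⟩ := zeroSum_conversion_eq234_of_prop22 hc' h22
  obtain ⟨C₇, hC₇, D₂, h7⟩ := norm_Mratio_le_of_prop22 hc' h22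
  refine ⟨K, hK0, C₇, hC₇, max (max D₁ D₂) 3, fun D _ χ hD hq hp x hx H Hmax hHmax hH hHb => ?_⟩
  have hD₁ : D₁ ≤ D := (le_max_left _ _).trans ((le_max_left _ _).trans hD)
  have hD₂ : D₂ ≤ D := (le_max_right _ _).trans ((le_max_left _ _).trans hD)
  have hD3 : 3 ≤ D := (le_max_right _ _).trans hD
  have hℓ1 : 1 < ell D := one_lt_ell hD3
  have hℓpos : 0 < ell D := by linarith
  have hlogP : Real.log (bigP D) = ell D ^ 9 := by rw [bigP, Real.log_exp]
  have hα : 0 < alpha D := by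
    rw [alpha, hlogP]; exact div_pos Real.pi_pos (pow_pos hℓpos 9)
  have hℓ1pos : 0 < ell1 D := by rw [ell1]; positivity
  have hℓt : ell1 D < 2 * π * t0 D := by
    have h1 : ell1 D ≤ t0 D := pow_le_pow_right₀ hℓ1.le (by norm_num)
    have h2 : 0 < t0 D := lt_of_lt_of_le hℓ1pos h1
    nlinarith [Real.pi_gt_three]
  have hconvx := hconv D χ hD₁ hq hp x hx H Hmax hHmax hH hHb
  have h7x := h7 D χ hD₂ hq hp x hx
  -- names
  set F : ℂ → ℂ := fun s => Mfun x.ψ (s + beta1 c' D) / Mfun x.ψ s * H s * omegaW D s with hF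
  set Ssum := ∑ ρ ∈ finsetOf (zeroSet D x),
    ((‖x.ψ.LFunction (ρ + beta1 c' D) / deriv x.ψ.LFunction ρ‖ : ℝ) : ℂ) * H ρ * omegaW D ρ with hS
  set Jp := Lemma81.segInt (t0 D) (ell1 D) ((alpha D : ℝ) : ℂ) F with hJp
  set Jm := Lemma81.segInt (t0 D) (ell1 D) ((-alpha D : ℝ) : ℂ) F with hJm
  set Ip := ∫ v in (-ell1 D)..ell1 D,
    ‖H ((alpha D : ℂ) + s0 D + v * I)‖ * ‖omegaW D ((alpha D : ℂ) + s0 D + v * I)‖ with hIp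
  set Im' := ∫ v in (-ell1 D)..ell1 D,
    ‖H (((-alpha D : ℝ) : ℂ) + s0 D + v * I)‖ * ‖omegaW D (((-alpha D : ℝ) : ℂ) + s0 D + v * I)‖
    with hIm'
  -- the segment integrals: `‖J_z‖ ≤ C₇ 𝓛⁹ ∫‖H‖‖ω‖`
  have hseg : ∀ z : ℝ, (z = alpha D ∨ z = -alpha D) →
      ‖Lemma81.segInt (t0 D) (ell1 D) ((z : ℝ) : ℂ) F‖ ≤
        C₇ * ell D ^ 9 * ∫ v in (-ell1 D)..ell1 D,
          ‖H ((z : ℂ) + s0 D + v * I)‖ * ‖omegaW D ((z : ℂ) + s0 D + v * I)‖ := by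
    intro z hz
    have hcont := continuousOn_normH_mul_normOmega (D := D) H hH z hℓt
    have hint : IntervalIntegrable (fun v : ℝ => C₇ * ell D ^ 9 *
        (‖H ((z : ℂ) + s0 D + v * I)‖ * ‖omegaW D ((z : ℂ) + s0 D + v * I)‖)) volume
        (-ell1 D) (ell1 D) := by
      refine ((continuousOn_const.mul hcont).mono ?_).intervalIntegrable
      rw [Set.uIcc_of_le (by linarith)]
    have hpt : ∀ᵐ v : ℝ ∂volume, v ∈ Set.Ioc (-ell1 D) (ell1 D) →
        ‖F ((z : ℂ) + s0 D + v * I)‖ ≤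
          C₇ * ell D ^ 9 * (‖H ((z : ℂ) + s0 D + v * I)‖ * ‖omegaW D ((z : ℂ) + s0 D + v * I)‖) := by
      refine Filter.Eventually.of_forall fun v hv => ?_
      have hvabs : |v| ≤ ell1 D := by rw [abs_le]; exact ⟨hv.1.le, hv.2⟩
      have hM := h7x z hz v hvabs
      rw [hlogP] at hM
      simp only [hF]
      rw [norm_mul, norm_mul]
      have h0 : 0 ≤ ‖H ((z : ℂ) + s0 D + v * I)‖ * ‖omegaW D ((z : ℂ) + s0 D + v * I)‖ := by
        positivity
      calc ‖Mfun x.ψ ((z : ℂ) + s0 D + v * I + beta1 c' D) / Mfun x.ψ ((z : ℂ) + s0 D + v * I)‖ *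
            ‖H ((z : ℂ) + s0 D + v * I)‖ * ‖omegaW D ((z : ℂ) + s0 D + v * I)‖
          = ‖Mfun x.ψ ((z : ℂ) + s0 D + v * I + beta1 c' D) / Mfun x.ψ ((z : ℂ) + s0 D + v * I)‖ *
            (‖H ((z : ℂ) + s0 D + v * I)‖ * ‖omegaW D ((z : ℂ) + s0 D + v * I)‖) := by ring
        _ ≤ C₇ * ell D ^ 9 *
            (‖H ((z : ℂ) + s0 D + v * I)‖ * ‖omegaW D ((z : ℂ) + s0 D + v * I)‖) :=
          mul_le_mul_of_nonneg_right hM h0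
    have hI := intervalIntegral.norm_integral_le_of_norm_le (by linarith : -ell1 D ≤ ell1 D) hpt hint
    rw [intervalIntegral.integral_const_mul] at hI
    have hI0 : 0 ≤ ∫ v in (-ell1 D)..ell1 D,
        ‖H ((z : ℂ) + s0 D + v * I)‖ * ‖omegaW D ((z : ℂ) + s0 D + v * I)‖ :=
      intervalIntegral.integral_nonneg (by linarith) fun v _ => by positivity
    rw [Lemma81.segInt_def]
    have hpre : ‖(1 / (2 * π) : ℂ)‖ ≤ 1 := by
      rw [show (1 / (2 * π) : ℂ) = ((1 / (2 * π) : ℝ) : ℂ) by push_cast; ring, Complex.norm_real,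
        Real.norm_of_nonneg (by positivity)]
      rw [div_le_one (by positivity)]; linarith [Real.pi_gt_three]
    have hs0 : ∀ v : ℝ, ((z : ℝ) : ℂ) + SmoothWeight.s0 (t0 D) + (v : ℂ) * I =
        (z : ℂ) + s0 D + v * I := fun v => rfl
    simp only [hs0]
    rw [norm_mul]
    calc ‖(1 / (2 * π) : ℂ)‖ * ‖∫ v in (-ell1 D)..ell1 D, F ((z : ℂ) + s0 D + v * I)‖
        ≤ 1 * (C₇ * ell D ^ 9 * ∫ v in (-ell1 D)..ell1 D,
            ‖H ((z : ℂ) + s0 D + v * I)‖ * ‖omegaW D ((z : ℂ) + s0 D + v * I)‖) :=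
          mul_le_mul hpre hI (norm_nonneg _) zero_le_one
      _ = _ := one_mul _
  have hJp' : ‖Jp‖ ≤ C₇ * ell D ^ 9 * Ip := by
    have h := hseg (alpha D) (Or.inl rfl)
    simpa only [hJp, hIp] using h
  have hJm' : ‖Jm‖ ≤ C₇ * ell D ^ 9 * Im' := by
    have h := hseg (-alpha D) (Or.inr rfl)
    simpa only [hJm, hIm'] using h
  -- assemble
  have hdecomp : Ssum = (Ssum + I * (Jp - Jm)) - I * (Jp - Jm) := by ring
  calc ‖Ssum‖ = ‖(Ssum + I * (Jp - Jm)) - I * (Jp - Jm)‖ := by rw [← hdecomp]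
    _ ≤ ‖Ssum + I * (Jp - Jm)‖ + ‖I * (Jp - Jm)‖ := norm_sub_le _ _
    _ ≤ K * Hmax * Real.exp (-(ell D ^ 10 / 8)) + (‖Jp‖ + ‖Jm‖) := by
        refine add_le_add hconvx ?_
        rw [norm_mul, Complex.norm_I, one_mul]
        exact norm_sub_le _ _
    _ ≤ K * Hmax * Real.exp (-(ell D ^ 10 / 8)) + (C₇ * ell D ^ 9 * Ip + C₇ * ell D ^ 9 * Im') := by
        gcongr
    _ = C₇ * ell D ^ 9 * (Ip + Im') + K * Hmax * Real.exp (-(ell D ^ 10 / 8)) := by ring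

/-- **The generic zero-sum bound for every sufficiently large `c′`, NO hypothesis** (Prop. 2.2 is a
tree theorem for large `c′`: `Skeleton.prop22_eventually`). [cite: Zhang2022LandauSiegel, §13 p.75] -/
theorem zeroSum_weight_le_eventually : ∃ c₀ : ℝ, 0 ≤ c₀ ∧ ∀ c' : ℝ, c₀ ≤ c' →
    ∃ K : ℝ, 0 ≤ K ∧ ∃ C : ℝ, 0 ≤ C ∧ ForAllLarge fun D _ χ => ∀ x ∈ PsiOne χ,
      ∀ (H : ℂ → ℂ) (Hmax : ℝ), 0 ≤ Hmax → (∀ z : ℂ, 0 < z.im → DifferentiableAt ℂ H z) →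
      (∀ s : ℂ, |s.re - 1 / 2| ≤ alpha D → |s.im - 2 * π * t0 D| ≤ ell1 D + 1 → ‖H s‖ ≤ Hmax) →
      ‖∑ ρ ∈ finsetOf (zeroSet D x),
          ((‖x.ψ.LFunction (ρ + beta1 c' D) / deriv x.ψ.LFunction ρ‖ : ℝ) : ℂ) * H ρ * omegaW D ρ‖ ≤
        C * ell D ^ 9 *
            ((∫ v in (-ell1 D)..ell1 D,
                ‖H ((alpha D : ℂ) + s0 D + v * I)‖ * ‖omegaW D ((alpha D : ℂ) + s0 D + v * I)‖) +
              (∫ v in (-ell1 D)..ell1 D,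
                ‖H (((-alpha D : ℝ) : ℂ) + s0 D + v * I)‖ *
                  ‖omegaW D (((-alpha D : ℝ) : ℂ) + s0 D + v * I)‖)) +
          K * Hmax * Real.exp (-(ell D ^ 10 / 8)) := by
  obtain ⟨c₀, hc₀, h⟩ := prop22_eventually
  exact ⟨c₀, hc₀, fun c' hc' => zeroSum_weight_le_of_prop22 (hc₀.trans hc') (h c' hc')⟩

end Literature.NumberTheory.LFunctions.Zhang2022.Typed.Section13

end
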